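import Literature.Analysis.FluidPDE.TaoCascadeZeroScaleGrowth
import Mathlib.Analysis.Calculus.Deriv.Inv
import HarnessLib

/-!
# Tao's cascade ODE, §6.7: tools for Prop. 6.17 ("No exit to coarse scales")

T. Tao, *Finite time blowup for an averaged three-dimensional Navier–Stokes equation*,
J. Amer. Math. Soc. **29** (2016), 601–674 = arXiv:1402.0290v3, §6.7, proof of Prop. 6.17: the
energy `Ẽ₋₁` of the next coarser scale is shown to be `≲ K^{-14}` on `[t_c, τ₁]` through the
modified energy `E* := Ẽ₋₁ - ½(1+ε₀)^{5/2}K a₋₁d₋₁ (ε²/c₋₁) a₀`, for which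
`∂ₜE* ≤ -½K(a₋₁²+d₋₁²)a₀ + O(K^{-14})` and then `∂ₜE* ≤ -(K a₀/2)·E* + O(K^{-14})` "by Lemma 6.9",
concluded "by Gronwall's inequality". This file provides the three ingredients as stand-alone
statements with free parameters and explicit constants:

* `correction_hasDerivWithinAt` and `coarseModifiedEnergy_algebra`: the derivative of the
  correction `a d b/(ρ c)` (product/quotient rule for one-sided derivatives) and the pointwise
  algebra `Ė - ½κ Q ≤ -½κ(a²+d²) b + θ₁ + Θ` from the energy inequality (6.49) at scale `-1`
  (`Ė ≤ -κ d² b + θ₁`), the `a₋₁`/`d₋₁`-equations (6.134)/(6.137) and the bounds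
  (6.172)–(6.173) (here `(a, d, b, c) = (a₋₁, d₋₁, a₀, c₋₁)`, `ρ = (1+ε₀)^{-5/2}ε⁻²`, `κ = K`);
* `coarse_rate_algebra`: `-½κ(a²+d²) b ≤ -κ b E* + κ M₀ (χ + ½(b₋₁²+c₋₁²) + η₉)` for **both signs**
  of `b = a₀` (the source's "`∂ₜE* ≤ -½K(1+ε₀)^{-5/2} E* a₀`", via the energy defect of Lemma 6.9);
* `le_of_oscillating_rate`: the Grönwall step with the *signed* rate `-κ a₀(t)`:
  if `E' ≤ -κ a₀ E + g` and `∫ₛᵗ a₀ ≥ -λ` for all `a ≤ s ≤ t`, then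
  `E(t) ≤ e^{-κ∫_a^t a₀} E(a) + g (t-a) e^{κλ}`. The source asks only for `∫₀ᵗ a₀ ≳ 1`; the
  uniform lower bound on `∫ₛᵗ a₀` that the variable-sign kernel needs is supplied on the drain
  interval by `TaoCascadeRotorAveraging.lean`.

## References

* T. Tao, J. Amer. Math. Soc. 29 (2016), 601–674, arXiv:1402.0290v3, §6.6 (6.134)–(6.137), §6.7
  proof of Prop. 6.17 ((6.172)–(6.178) and the displays following them). [`Tao2016AveragedNS`]
-/

noncomputable section

open Set MeasureTheory intervalIntegral Filter Topology

namespace Literature.Analysis.FluidPDE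

namespace TaoCascade

open Literature.Analysis.ODE

/-! ## The correction term and its derivative -/

/-- The one-sided derivative of the correction `u ↦ a u · d u · b u / (ρ c u)` at a point where
`ρ c ≠ 0`. [cite: Tao2016AveragedNS, §6.7 proof of Prop. 6.17] -/
theorem correction_hasDerivWithinAt {τ₀ ρ : ℝ} {a d b c : ℝ → ℝ} (ha : ContDiffOn ℝ 1 a (Ici τ₀))
    (hd : ContDiffOn ℝ 1 d (Ici τ₀)) (hb : ContDiffOn ℝ 1 b (Ici τ₀)) (hc : ContDiffOn ℝ 1 c (Ici τ₀))
    {s : ℝ} (hs : τ₀ ≤ s) (hρc : ρ * c s ≠ 0) :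
    HasDerivWithinAt (fun u => a u * d u * b u / (ρ * c u))
      ((((derivWithin a (Ici τ₀) s * d s + a s * derivWithin d (Ici τ₀) s) * b s +
            a s * d s * derivWithin b (Ici τ₀) s) * (ρ * c s) -
          a s * d s * b s * (ρ * derivWithin c (Ici τ₀) s)) / (ρ * c s) ^ 2)
      (Ici s) s := by
  have h0 := hasDerivWithinAt_Ici_of_contDiffOn ha hs
  have h3 := hasDerivWithinAt_Ici_of_contDiffOn hd hs
  have h2 := (hasDerivWithinAt_Ici_of_contDiffOn hc hs).const_mul ρ
  have h4 := hasDerivWithinAt_Ici_of_contDiffOn hb hs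
  exact ((h0.fun_mul h3).fun_mul h4).fun_div h2 hρc

/-- **Pointwise algebra of `∂ₜE*`, `E* = Ẽ₋₁ - ½κ·a d b/(ρ c)`.** Real-variable form at one time:
`A, D, B, C` the values of `a₋₁, d₋₁, a₀, c₋₁` (`C > 0`, `1/(ρC) ≤ w₁`, `|A|, |D| ≤ M₁`, `|B| ≤ M₀`),
`A', D', B', C'` their derivative values with the equations `|A' + ρ C D| ≤ η₁` ((6.134)),
`|D' - (ρ C A - κ D B)| ≤ η₂` ((6.137)), `|B'| ≤ β₀`, `|C'| ≤ L C` ((6.173)), and the energy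
inequality value `Ė ≤ -κ D² B + θ₁` ((6.49) at scale `-1` with the `d₋₂²a₋₁` term bounded by
`θ₁`); `ρ > 0`, `κ ≥ 0`. Then with the derivative value `Q` of the correction
(`correction_hasDerivWithinAt`): `Ė - ½κ Q ≤ -½κ(A²+D²)B + θ₁ + ½κ w₁ (κM₁²M₀² + (η₁+η₂)M₁M₀ + M₁²β₀ + M₁²M₀L)`.
[cite: Tao2016AveragedNS, §6.7 proof of Prop. 6.17] -/
theorem coarseModifiedEnergy_algebra {A D B C A' D' B' C' Eder ρ κ η₁ η₂ β₀ L M₁ M₀ w₁ θ₁ : ℝ}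
    (hρ : 0 < ρ) (hκ : 0 ≤ κ) (hC : 0 < C) (hw : 1 / (ρ * C) ≤ w₁) (hcL : |C'| ≤ L * C)
    (ha : |A| ≤ M₁) (hd : |D| ≤ M₁) (hb : |B| ≤ M₀) (hB' : |B'| ≤ β₀)
    (he₁ : |A' + ρ * C * D| ≤ η₁) (he₄ : |D' - (ρ * C * A - κ * D * B)| ≤ η₂)
    (hE : Eder ≤ -κ * D ^ 2 * B + θ₁) :
    Eder - (1 / 2) * κ * ((((A' * D + A * D') * B + A * D * B') * (ρ * C) - A * D * B * (ρ * C')) /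
        (ρ * C) ^ 2) ≤
      -(1 / 2) * κ * (A ^ 2 + D ^ 2) * B + θ₁ +
        (1 / 2) * κ * w₁ * (κ * M₁ ^ 2 * M₀ ^ 2 + (η₁ + η₂) * M₁ * M₀ + M₁ ^ 2 * β₀ +
          M₁ ^ 2 * M₀ * L) := by
  have hM1 : 0 ≤ M₁ := (abs_nonneg _).trans ha
  have hM0 : 0 ≤ M₀ := (abs_nonneg _).trans hb
  have hη₁ : 0 ≤ η₁ := (abs_nonneg _).trans he₁
  have hη₂ : 0 ≤ η₂ := (abs_nonneg _).trans he₄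
  have hβ₀ : 0 ≤ β₀ := (abs_nonneg _).trans hB'
  have hC0 : C ≠ 0 := hC.ne'
  have hρ0 : ρ ≠ 0 := hρ.ne'
  have hL0 : 0 ≤ L := nonneg_of_mul_nonneg_left ((abs_nonneg _).trans hcL) hC
  obtain ⟨e₁, rfl⟩ : ∃ e₁, A' = e₁ - ρ * C * D := ⟨A' + ρ * C * D, by ring⟩
  obtain ⟨e₄, rfl⟩ : ∃ e₄, D' = e₄ + (ρ * C * A - κ * D * B) :=
    ⟨D' - (ρ * C * A - κ * D * B), by ring⟩
  have hb₁ : |e₁| ≤ η₁ := by simpa using he₁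
  have hb₄ : |e₄| ≤ η₂ := by simpa using he₄
  set w : ℝ := 1 / (ρ * C) with hwdef
  have hw0 : 0 < w := by rw [hwdef]; positivity
  have hws : w ≤ w₁ := hw
  have key : ((((e₁ - ρ * C * D) * D + A * (e₄ + (ρ * C * A - κ * D * B))) * B + A * D * B') *
        (ρ * C) - A * D * B * (ρ * C')) / (ρ * C) ^ 2 =
      (A ^ 2 - D ^ 2) * B +
        (-(κ * A * D * B ^ 2) * w + (e₁ * D + A * e₄) * B * w + A * D * B' * w -
          A * D * B * (C' / C) * w) := by
    simp only [hwdef]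
    field_simp
    ring
  rw [key]
  have hAD : |A| * |D| ≤ M₁ ^ 2 := by nlinarith [abs_nonneg A, abs_nonneg D]
  have t1 : |κ * A * D * B ^ 2 * w| ≤ κ * M₁ ^ 2 * M₀ ^ 2 * w₁ := by
    rw [abs_mul, abs_mul, abs_mul, abs_mul, abs_of_nonneg hκ, abs_of_pos hw0, abs_pow]
    have hB2 : |B| ^ 2 ≤ M₀ ^ 2 := pow_le_pow_left₀ (abs_nonneg _) hb 2
    calc κ * |A| * |D| * |B| ^ 2 * w = κ * (|A| * |D|) * |B| ^ 2 * w := by ring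
      _ ≤ κ * M₁ ^ 2 * M₀ ^ 2 * w₁ := by gcongr
  have t2 : |(e₁ * D + A * e₄) * B * w| ≤ (η₁ + η₂) * M₁ * M₀ * w₁ := by
    rw [abs_mul, abs_mul, abs_of_pos hw0]
    have h12 : |e₁ * D + A * e₄| ≤ (η₁ + η₂) * M₁ := by
      calc |e₁ * D + A * e₄| ≤ |e₁ * D| + |A * e₄| := abs_add_le _ _
        _ = |e₁| * |D| + |A| * |e₄| := by rw [abs_mul, abs_mul]
        _ ≤ η₁ * M₁ + M₁ * η₂ :=
            add_le_add (mul_le_mul hb₁ hd (abs_nonneg _) hη₁) (mul_le_mul ha hb₄ (abs_nonneg _) hM1)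
        _ = (η₁ + η₂) * M₁ := by ring
    calc |e₁ * D + A * e₄| * |B| * w ≤ (η₁ + η₂) * M₁ * M₀ * w₁ :=
          mul_le_mul (mul_le_mul h12 hb (abs_nonneg _) (by positivity)) hws hw0.le (by positivity)
      _ = _ := rfl
  have t3 : |A * D * B' * w| ≤ M₁ ^ 2 * β₀ * w₁ := by
    rw [abs_mul, abs_mul, abs_mul, abs_of_pos hw0]
    calc |A| * |D| * |B'| * w ≤ M₁ ^ 2 * β₀ * w₁ :=
          mul_le_mul (mul_le_mul hAD hB' (abs_nonneg _) (by positivity)) hws hw0.le (by positivity)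
      _ = _ := rfl
  have t4 : |A * D * B * (C' / C) * w| ≤ M₁ ^ 2 * M₀ * L * w₁ := by
    simp only [abs_mul, abs_div, abs_of_pos hw0, abs_of_pos hC]
    have hcL' : |C'| / C ≤ L := by rw [div_le_iff₀ hC]; exact hcL
    have h1 : |A| * |D| * |B| ≤ M₁ ^ 2 * M₀ := mul_le_mul hAD hb (abs_nonneg _) (by positivity)
    have h2 : |A| * |D| * |B| * (|C'| / C) ≤ M₁ ^ 2 * M₀ * L :=
      mul_le_mul h1 hcL' (by positivity) (by positivity)
    exact mul_le_mul h2 hws hw0.le (by positivity)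
  have hbr : -(-(κ * A * D * B ^ 2) * w + (e₁ * D + A * e₄) * B * w + A * D * B' * w -
      A * D * B * (C' / C) * w) ≤
      κ * M₁ ^ 2 * M₀ ^ 2 * w₁ + (η₁ + η₂) * M₁ * M₀ * w₁ + M₁ ^ 2 * β₀ * w₁ +
        M₁ ^ 2 * M₀ * L * w₁ := by
    have u1 := le_abs_self (κ * A * D * B ^ 2 * w)
    have u2 := neg_abs_le ((e₁ * D + A * e₄) * B * w)
    have u3 := neg_abs_le (A * D * B' * w)
    have u4 := le_abs_self (A * D * B * (C' / C) * w)
    linarith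
  have hκ2 : 0 ≤ (1 / 2) * κ := by positivity
  have hB := mul_le_mul_of_nonneg_left hbr hκ2
  nlinarith [hE, hB]

/-- **The signed rate: `-½κ(A²+D²)B ≤ -κ B E* + κ M₀ (χ + s + η₉)` for both signs of `B`.**
Here `E* = E - corr` with `|corr| ≤ χ`, the energy defect `s₀ := ½(A²+D²)` obeys
`s₀ + s ≤ E ≤ s₀ + s + η₉` with `s ≥ 0` (the contribution `½(b₋₁²+c₋₁²)` of the secondary modes)
and `η₉ ≥ 0` (Lemma 6.9), `|B| ≤ M₀`, `κ ≥ 0`. [cite: Tao2016AveragedNS, §6.7 proof of Prop. 6.17] -/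
theorem coarse_rate_algebra {A D B E corr χ s η₉ M₀ κ : ℝ} (hκ : 0 ≤ κ) (hb : |B| ≤ M₀)
    (hcorr : |corr| ≤ χ) (hs : 0 ≤ s) (hη₉ : 0 ≤ η₉)
    (hElo : (1 / 2) * (A ^ 2 + D ^ 2) + s ≤ E) (hEhi : E ≤ (1 / 2) * (A ^ 2 + D ^ 2) + s + η₉) :
    -(1 / 2) * κ * (A ^ 2 + D ^ 2) * B ≤ -κ * B * (E - corr) + κ * M₀ * (χ + s + η₉) := by
  have hM0 : 0 ≤ M₀ := (abs_nonneg _).trans hb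
  have hχ : 0 ≤ χ := (abs_nonneg _).trans hcorr
  have hs₀ : 0 ≤ (1 / 2) * (A ^ 2 + D ^ 2) := by positivity
  rcases le_or_gt 0 B with hB | hB
  · -- `B ≥ 0`: use the upper defect bound
    have hBM : B ≤ M₀ := (le_abs_self B).trans hb
    have h1 : -(1 / 2) * κ * (A ^ 2 + D ^ 2) * B ≤ -κ * B * (E - s - η₉) := by
      have : E - s - η₉ ≤ (1 / 2) * (A ^ 2 + D ^ 2) := by linarith
      have hκB : 0 ≤ κ * B := mul_nonneg hκ hB
      nlinarith
    have h2 : -κ * B * (E - s - η₉) = -κ * B * (E - corr) + κ * B * (s + η₉ - corr) := by ring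
    rw [h2] at h1
    have h3 : κ * B * (s + η₉ - corr) ≤ κ * M₀ * (χ + s + η₉) := by
      have hc : s + η₉ - corr ≤ χ + s + η₉ := by linarith [neg_abs_le corr]
      calc κ * B * (s + η₉ - corr) ≤ κ * B * (χ + s + η₉) :=
            mul_le_mul_of_nonneg_left hc (mul_nonneg hκ hB)
        _ ≤ κ * M₀ * (χ + s + η₉) := by
            apply mul_le_mul_of_nonneg_right (mul_le_mul_of_nonneg_left hBM hκ)
            positivity
    linarith
  · -- `B < 0`: use the lower defect bound
    have hBM : -B ≤ M₀ := (neg_le_abs B).trans hb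
    have h1 : -(1 / 2) * κ * (A ^ 2 + D ^ 2) * B ≤ -κ * B * E := by
      have : (1 / 2) * (A ^ 2 + D ^ 2) ≤ E := by linarith
      have hκB : 0 ≤ κ * (-B) := mul_nonneg hκ (by linarith)
      nlinarith
    have h2 : -κ * B * E = -κ * B * (E - corr) + κ * (-B) * corr := by ring
    rw [h2] at h1
    have h3 : κ * (-B) * corr ≤ κ * M₀ * (χ + s + η₉) := by
      have hc : corr ≤ χ + s + η₉ := by linarith [le_abs_self corr]
      calc κ * (-B) * corr ≤ κ * (-B) * (χ + s + η₉) :=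
            mul_le_mul_of_nonneg_left hc (mul_nonneg hκ (by linarith))
        _ ≤ κ * M₀ * (χ + s + η₉) := by
            apply mul_le_mul_of_nonneg_right (mul_le_mul_of_nonneg_left hBM hκ)
            positivity
    linarith

/-! ## Grönwall with a signed, oscillating rate -/

/-- **Grönwall with the signed rate `-κ a₀(t)`.** Let `E` be continuous on `[a, b]` with right
derivative `E'` on `[a, b)`, `a₀` continuous on `[a, b]`, `κ, g ≥ 0`, and `E' ≤ -κ a₀ E + g` on
`[a, b)`. If `t ∈ [a, b]` and `∫ₛᵗ a₀ ≥ -λ` for every `s ∈ [a, t]`, then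
`E(t) ≤ e^{-κ ∫_a^t a₀} E(a) + g (t-a) e^{κλ}`. [cite: Tao2016AveragedNS, §6.7 proof of Prop. 6.17] -/
theorem le_of_oscillating_rate {a b : ℝ} {E E' a₀ : ℝ → ℝ} {κ g lam : ℝ}
    (hE : ContinuousOn E (Icc a b)) (hE' : ∀ t ∈ Ico a b, HasDerivWithinAt E (E' t) (Ici t) t)
    (ha₀ : ContinuousOn a₀ (Icc a b)) (hκ : 0 ≤ κ) (hg : 0 ≤ g)
    (bound : ∀ t ∈ Ico a b, E' t ≤ -κ * a₀ t * E t + g) {t : ℝ} (ht : t ∈ Icc a b)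
    (hlam : ∀ s ∈ Icc a t, -lam ≤ ∫ u in s..t, a₀ u) :
    E t ≤ Real.exp (-(κ * ∫ u in a..t, a₀ u)) * E a + g * (t - a) * Real.exp (κ * lam) := by
  have hβc : ContinuousOn (fun s => -κ * a₀ s) (Icc a b) := continuousOn_const.mul ha₀
  have hcomp := le_linearComparison hE hE' (A := fun _ => g) (β := fun s => -κ * a₀ s)
    continuousOn_const hβc (fun s hs => by have := bound s hs; linarith) ht
  set B : ℝ → ℝ := fun s => ∫ u in a..s, -κ * a₀ u with hB
  have hβi : ∀ {x y : ℝ}, a ≤ x → x ≤ y → y ≤ b → IntervalIntegrable (fun u => -κ * a₀ u) volume x y :=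
    fun hx hxy hy => (hβc.mono (Icc_subset_Icc hx hy)).intervalIntegrable_of_Icc hxy
  have hBt : B t = -(κ * ∫ u in a..t, a₀ u) := by
    simp only [hB, intervalIntegral.integral_const_mul]; ring
  -- kernel bound `B t - B s ≤ κ λ`
  have hker : ∀ s ∈ Icc a t, B t - B s ≤ κ * lam := by
    intro s hs
    have hsplit : B t - B s = ∫ u in s..t, -κ * a₀ u := by
      simp only [hB]
      rw [← integral_add_adjacent_intervals (hβi le_rfl hs.1 (hs.2.trans ht.2))
        (hβi hs.1 hs.2 ht.2)]
      ring
    rw [hsplit, intervalIntegral.integral_const_mul]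
    have := hlam s hs
    nlinarith
  have hBc : ContinuousOn B (Icc a b) := continuousOn_primitive_Icc hβc
  have hwc : ContinuousOn (fun s => (fun _ : ℝ => g) s * Real.exp (-B s)) (Icc a t) :=
    continuousOn_const.mul ((hBc.mono (Icc_subset_Icc le_rfl ht.2)).neg.rexp)
  have hint : Real.exp (B t) * ∫ s in a..t, (fun _ : ℝ => g) s * Real.exp (-B s) ≤
      g * (t - a) * Real.exp (κ * lam) := by
    rw [← intervalIntegral.integral_const_mul]
    have h1 : ∫ s in a..t, Real.exp (B t) * ((fun _ : ℝ => g) s * Real.exp (-B s)) ≤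
        ∫ s in a..t, g * Real.exp (κ * lam) := by
      apply integral_mono_on ht.1 ((hwc.intervalIntegrable_of_Icc ht.1).const_mul _)
        (continuous_const.intervalIntegrable _ _)
      intro s hs
      have hexp : Real.exp (B t) * Real.exp (-B s) ≤ Real.exp (κ * lam) := by
        rw [← Real.exp_add, Real.exp_le_exp]; linarith [hker s hs]
      calc Real.exp (B t) * ((fun _ : ℝ => g) s * Real.exp (-B s))
          = g * (Real.exp (B t) * Real.exp (-B s)) := by ring
        _ ≤ g * Real.exp (κ * lam) := mul_le_mul_of_nonneg_left hexp hg
    have h2 : ∫ s in a..t, g * Real.exp (κ * lam) = g * (t - a) * Real.exp (κ * lam) := by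
      simp only [intervalIntegral.integral_const, smul_eq_mul]; ring
    linarith
  calc E t ≤ Real.exp (B t) * (E a + ∫ s in a..t, (fun _ : ℝ => g) s * Real.exp (-B s)) := hcomp
    _ = Real.exp (B t) * E a + Real.exp (B t) * ∫ s in a..t, (fun _ : ℝ => g) s * Real.exp (-B s) := by
        ring
    _ ≤ Real.exp (-(κ * ∫ u in a..t, a₀ u)) * E a + g * (t - a) * Real.exp (κ * lam) := by
        rw [← hBt]; linarith [hint]

end TaoCascade

end Literature.Analysis.FluidPDE
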